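import Literature.Computability.Complexity.OrLanguageSpace
import Literature.Computability.MetaComplexity.Hirahara2020.ReadOnceBranchingProgramsDL
import Literature.Computability.MetaComplexity.Hirahara2020.SmallBPYesJunta
import HarnessLib

/-!
# R28: rendering (II)'s YES side is NOT contained in rendering (I)'s (PROVED)

Row R28 of the magnification census (Hirahara, ToC 19(4) 2023, Thm. 1.13) has two tree renderings
of the YES side `DSPACE(cn)/ₙ cn` of its promise problem: (I) `smallBPYes c` — truth tables of
deterministic branching programs of size `≤ cn/⌊log₂ n⌋`, all JUNTAS
(`SmallBPYesJunta.lean`) — and (II) `dlYes c` — truth tables of functions computed on `{0,1}ⁿ` in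
work space `≤ cn` by a bounded-hardware space machine of rendered description length `≤ cn`
(census D13).  This file proves the separation recorded as prose in census part IV
(`MagnificationGapCensus/ReadOnceBranchingProgramsDL.lean`, F36): **for every `c' ≥ 1` and every
`c`, at every length `n ≥ max 7 2^{c+1}` some YES instance of rendering (II) is not a YES instance
of rendering (I)** — witnessed by the truth table of the `n`-bit OR, which is computed by the
seven-node OR machine of `Complexity/OrLanguageSpace.lean` (so lies in `dlYes c'`, `or_mem_dlYes`)
and depends on every variable (so lies in no `smallBPYes c`, `or_not_mem_smallBPYes`).  Hence
neither rendering's YES side contains the other at large lengths (the converse non-containment is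
NOT claimed: whether every small read-once-free branching program is simulated by a bounded-
hardware machine within the rendered description length is a separate formalisation, census IV
hypothesis `hincl`).  Proofs only; nothing here bears on a summit.
-/

namespace Literature.Computability.MetaComplexity.Hirahara2020

open Filter
open Literature.Computability.Complexity

/-- The `n`-bit OR depends on every variable: flipping coordinate `i` of the all-`false` input
changes it. [folklore] -/
theorem or_depends {n : ℕ} (i : Fin n) :
    ∃ v : Fin n → Bool, decide (∃ j, v j = true) ≠
      decide (∃ j, Function.update v i (!v i) j = true) := by
  refine ⟨fun _ => false, ?_⟩
  have h1 : ¬ ∃ j : Fin n, (fun _ : Fin n => false) j = true := by simp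
  have h2 : ∃ j : Fin n, Function.update (fun _ : Fin n => false) i (!false) j = true :=
    ⟨i, by simp⟩
  rw [decide_eq_false h1, decide_eq_true h2]
  decide

/-- **The `n`-bit OR is a YES instance of rendering (II)** for every `c ≥ 1` and `n ≥ 7`
(OR machine: description length `7 ≤ c·n`, work space `1 ≤ c·n`). [folklore] -/
theorem or_mem_dlYes {c n : ℕ} (hc : 1 ≤ c) (hn : 7 ≤ n) :
    truthTable (fun v : Fin n → Bool => decide (∃ i, v i = true)) ∈ dlYes c := by
  have hcn : 7 ≤ c * n := hn.trans (by simpa using Nat.mul_le_mul_right n hc)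
  exact ⟨n, _, rfl, or_mem_DSPACEdl (le_trans (by norm_num) hcn) hcn n⟩

/-- **The `n`-bit OR is NOT a YES instance of rendering (I)** for `n ≥ 2^{c+1}` (it is no junta on
`< n` variables). [folklore] -/
theorem or_not_mem_smallBPYes {c n : ℕ} (hn : 2 ^ (c + 1) ≤ n) :
    truthTable (fun v : Fin n → Bool => decide (∃ i, v i = true)) ∉ smallBPYes c :=
  truthTable_not_mem_smallBPYes_of_forall_depends hn fun i => or_depends i

/-- **Rendering (II) ⊄ rendering (I) at every large length**: for `c' ≥ 1`, every `c` and every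
`n ≥ max 7 2^{c+1}` there is a string of length `2^n` in `dlYes c'` and outside `smallBPYes c`.
[folklore] -/
theorem exists_mem_dlYes_not_mem_smallBPYes {c' : ℕ} (hc' : 1 ≤ c') (c : ℕ) {n : ℕ}
    (hn7 : 7 ≤ n) (hn : 2 ^ (c + 1) ≤ n) :
    ∃ x : List Bool, x.length = 2 ^ n ∧ x ∈ dlYes c' ∧ x ∉ smallBPYes c :=
  ⟨_, length_truthTable _, or_mem_dlYes hc' hn7, or_not_mem_smallBPYes hn⟩

/-- The same along the promise problems of the two renderings, eventually in `n`: for `c' ≥ 1` the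
YES side of the `c'`-th member of rendering (II) is, at all large lengths, not contained in the YES
side of the `c`-th member of rendering (I) (any parameters `α, ρ, α', ρ'` — the YES sides do not
depend on them). [folklore] -/
theorem eventually_exists_mem_dlYes_not_mem_smallBPYes {c' : ℕ} (hc' : 1 ≤ c') (c : ℕ)
    (α ρ α' ρ' : ℝ) :
    ∀ᶠ n : ℕ in atTop, ∃ x : List Bool, x.length = 2 ^ n ∧
      x ∈ (DSPACEdlVsApproxSIZE c' α ρ).yes ∧ x ∉ (DSPACEvsApproxSIZE c α' ρ').yes := by
  filter_upwards [eventually_ge_atTop (max 7 (2 ^ (c + 1)))] with n hn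
  exact exists_mem_dlYes_not_mem_smallBPYes hc' c (le_of_max_le_left hn) (le_of_max_le_right hn)

/-- For `c' = 0` rendering (II)'s YES side is empty (no machine has description length `0`), so the
hypothesis `1 ≤ c'` above is necessary. [folklore] -/
theorem dlYes_zero : dlYes 0 = ∅ := by
  ext x
  simp only [Set.mem_empty_iff_false, iff_false]
  rintro ⟨n, f, -, M, -, hd, -⟩
  have hpos : 0 < M.descLen := by
    unfold SpaceMachine.descLen SpaceMachine.progNodes
    refine Nat.mul_pos ?_ (Nat.succ_pos _)
    exact Finset.sum_pos (fun q _ => stmtNodes_pos _) ⟨M.tm.main, @Finset.mem_univ _ M.tm.ΛFin _⟩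
  omega

end Literature.Computability.MetaComplexity.Hirahara2020
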